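import Mathlib
import HarnessLib
import Summits.QuantumAdvantage.QuantumAdvantage.Theses.CompactnessLift
import Literature.Computability.QuantumComplexity.BQTime
import Literature.Computability.Complexity.RelativizedTime

/-!
# Strategist sketch — crux `CompactnessPrinciple` (stmt-QuantumAdvantage-15270), route CompactnessLift

§0  the crux AS TYPED is an artefact (`bp (DTIME n^c)` = BPP by coin padding): `CompactnessPrinciple`
    follows from the routine padding lemma alone, and `LanguageLadder` gives the summit outright;
§1  the INTENDED crux `CP'` over the honest classes `BQTime` / `BPTime` (RelativizedTime.lean, BQTime.lean),
    its logic (`CP' ↔ (Ladder' → S)`, `S → CP'`);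
§2  the typed decomposition candidates D1 (selection ∧ uniform diagonalization), D2 (envelope language),
    D3 (promise lift), Dε (PP case split) with their assemblies PROVED — the census records which of the
    human's conditions (c)/(d) each violates;
§3  the negative side, typed: `OracleDichotomyPos` (relativized counterexample to CP').
-/

set_option linter.dupNamespace false
set_option linter.unusedVariables false

noncomputable section

namespace Summit.QuantumAdvantage.QuantumAdvantage.Cruxes.CompactnessPrinciple.Strategist

open Literature.Computability.Complexity Literature.Computability.Cryptography
  Literature.Computability.QuantumComplexity
open Summit.QuantumAdvantage.QuantumAdvantage.Theses.CompactnessLift (CompactnessPrinciple LanguageLadder)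

/-! ## §0 The crux as typed -/

/-- The quadratic level, literally the comprehension inlined by the route (`rfl`, BQTime.lean). -/
abbrev QuadQ : Set (Language Bool) := BQTime fun n => n ^ 2

/-- The coin-padding lemma of the refuter memo (routine TM2 construction, NOT a Literature fact):
the free coin polynomial of `bp` pads the inner input, so one absolute exponent covers `BPP`. -/
def PaddingCollapse : Prop := ∃ c₀ : ℕ, BPP ⊆ bp (DTIME fun n => n ^ c₀)

/-- `CompactnessPrinciple` AS TYPED follows from the padding lemma alone (`QuadQ ⊆ BQP` is the tree's
`BQTime_pow_subset_BQP 2`): the item carries no open content. -/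
theorem compactnessPrinciple_of_paddingCollapse (h : PaddingCollapse) : CompactnessPrinciple := by
  intro hsub
  obtain ⟨c₀, hc₀⟩ := h
  refine ⟨c₀, fun L hL => hc₀ (hsub ?_)⟩
  exact BQTime_pow_subset_BQP 2 hL

/-- … and `LanguageLadder` AS TYPED gives the summit outright (level `c₀` of the ladder is a `BQP`
language outside `bp (DTIME n^c₀) ⊇ BPP`). -/
theorem summit_of_languageLadder (h : PaddingCollapse) (hL : LanguageLadder) : QuantumAdvantage := by
  obtain ⟨c₀, hc₀⟩ := h
  obtain ⟨L, hLq, hLc⟩ := hL c₀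
  exact ⟨L, BQTime_pow_subset_BQP 2 hLq, fun hB => hLc (hc₀ hB)⟩

/-! ## §1 The intended crux over honest classes -/

/-- CP' — the compactness principle over `BPTime` (coins AND time `O(n^c)` measured in `|x|`). -/
def CP' : Prop := BQP ⊆ BPP → ∃ c : ℕ, QuadQ ⊆ BPTime fun n => n ^ c

/-- ¬UC' — the language ladder over `BPTime`. -/
def Ladder' : Prop := ∀ c : ℕ, ∃ L ∈ QuadQ, L ∉ BPTime fun n => n ^ c

/-- S → CP' (vacuously): CP' is a CONSEQUENCE of the summit, not summit-or-harder. -/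
theorem cp'_of_summit (h : QuantumAdvantage) : CP' := by
  intro hsub
  obtain ⟨L, hL, hLB⟩ := h
  exact absurd (hsub hL) hLB

/-- CP' ↔ (Ladder' → S): the intended crux is exactly the bridge of the bridge split S ⇐ T ∧ (T → S),
T = Ladder'. -/
theorem cp'_iff : CP' ↔ (Ladder' → QuantumAdvantage) := by
  constructor
  · intro h hlad
    by_contra hS
    have hsub : BQP ⊆ BPP := fun L hL => by
      by_contra hLB
      exact hS ⟨L, hL, hLB⟩
    obtain ⟨c, hc⟩ := h hsub
    obtain ⟨L, hL, hLc⟩ := hlad c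
    exact hLc (hc hL)
  · intro h hsub
    by_contra hne
    push Not at hne
    have hlad : Ladder' := fun c => by
      obtain ⟨L, hL, hLc⟩ := Set.not_subset.1 (hne c)
      exact ⟨L, hL, hLc⟩
    obtain ⟨L, hL, hLB⟩ := h hlad
    exact hLB (hsub hL)

/-! ## §2 Decomposition candidates (typed; assemblies proved) -/

/-! ### D1 — selection ∧ uniform diagonalization -/

/-- A COMPUTABLY WITNESSED ladder: ONE TM2 machine generates, on input `⟨1^c, 1^n⟩`, the `n`-th
circuit of the level-`c` witness within `C_c·n² + C_c` steps; level `c` decides some language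
outside `BPTime(n^c)`. (Intensional uniformity: the delayed diagonalization of `UnifDiag` clocks this
one machine; a merely extensional `Computable` generator would not do.) -/
def CWL' : Prop :=
  ∃ (Fs : ℕ → QCircuitFamily cliffordT) (Cs : ℕ → ℕ),
    (∃ M : Turing.TM2ComputableAux Bool Bool,
      ComputesInTime (fun p : ℕ × ℕ => boolPair (Computability.unaryEncodeNat p.1) (Computability.unaryEncodeNat p.2))
        (QCircuit.sigmaEncode (G := cliffordT))
        (fun p : ℕ × ℕ => (⟨p.2, (Fs p.1).ancillas p.2, (Fs p.1).circ p.2⟩ : Σ n m : ℕ, QCircuit cliffordT (n + m)))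
        (fun p => Cs p.1 * p.2 ^ 2 + Cs p.1) M) ∧
    ∀ c, (Fs c).IsOracleFree ∧ ∃ L : Language Bool,
      (∀ x, (x ∈ L → 2 / 3 ≤ (Fs c).acceptProbOn 0 x) ∧ (x ∉ L → (Fs c).acceptProbOn 0 x ≤ 1 / 3)) ∧
      L ∉ BPTime fun n => n ^ c

/-- D1 piece A' (OPEN, ≡ CP' modulo theorems): a ladder, if it exists, can be computably witnessed. -/
def Selection : Prop := Ladder' → CWL'

/-- D1 piece B' (THEOREM-TYPE, Schöning 1982 / Ladner 1975 delayed diagonalization; XL in Lean): a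
computably witnessed ladder glues into ONE `BQP` language outside `BPP`. -/
def UnifDiag : Prop := CWL' → QuantumAdvantage

/-- D1 assembly (pure logic). -/
theorem cp'_of_selection_unifDiag (hA : Selection) (hB : UnifDiag) : CP' :=
  cp'_iff.2 fun hlad => hB (hA hlad)

/-! ### D2 — envelope (uniformly hard) language -/

/-- D2 piece ENV' (OPEN, believed false; relativized-false in Sipser/Hartmanis–Hemachandra-type worlds):
some `BQP` language is uniformly hard for the quadratic level under fixed-polynomial-time many-one
reductions ("QuadQ has a syntactic envelope inside BQP"). -/
def Envelope : Prop :=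
  ∃ K ∈ BQP, ∃ d : ℕ, ∀ L ∈ QuadQ, ∃ f : List Bool → List Bool,
    f ∈ FTIME (fun n => n ^ d) ∧ ∀ x, x ∈ L ↔ f x ∈ K

/-- D2 piece (ROUTINE, TM2 construction): `BPTime` levels are closed under fixed-poly-time reductions
with a uniform exponent. -/
def BPTimeClosure : Prop :=
  ∀ d k : ℕ, ∃ c : ℕ, ∀ (K L : Language Bool) (f : List Bool → List Bool),
    f ∈ FTIME (fun n => n ^ d) → (∀ x, x ∈ L ↔ f x ∈ K) →
    K ∈ BPTime (fun n => n ^ k) → L ∈ BPTime fun n => n ^ c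

/-- D2/Dε piece (ROUTINE, TM2 construction; RelativizedTime.lean "Not here"): the hard half of
`BPP = ⋃ₖ BPTIME(nᵏ)`. -/
def BPPSlices : Prop := BPP ⊆ ⋃ k : ℕ, BPTime fun n => n ^ k

/-- D2 assembly. -/
theorem cp'_of_envelope (h₁ : Envelope) (h₂ : BPTimeClosure) (h₃ : BPPSlices) : CP' := by
  intro hsub
  obtain ⟨K, hK, d, hred⟩ := h₁
  obtain ⟨k, hk⟩ := Set.mem_iUnion.1 (h₃ (hsub hK))
  obtain ⟨c, hc⟩ := h₂ d k
  exact ⟨c, fun L hL => by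
    obtain ⟨f, hf, hfx⟩ := hred L hL
    exact hc K L f hf hfx hk⟩

/-! ### D3 — the promise lift (shared crux stmt-QuantumAdvantage-0250, FR-false) -/

/-- D3 piece: PlLift (stmt-0250 verbatim shape). -/
def PlLift : Prop := BQP ⊆ BPP → PromiseBQP ⊆ PromiseBPP'

/-- D3 piece (support 15273 retyped over `BPTime`; L-sized, known technique). -/
def PlImpliesCp' : Prop := PlLift → CP'

/-- D3 assembly (modus ponens — `trivial_seam`). -/
theorem cp'_of_plLift (h₁ : PlLift) (h₂ : PlImpliesCp') : CP' := h₂ h₁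

/-! ### Dε — case split on the counting collapse -/

/-- Dε piece (THEOREM-TYPE, XL: `BQTime(n²) ⊆ PPTIME(n^a)` uniformly (Adleman–DeMarrais–Huang) +
a PP-universal language under fixed-poly reductions + `BPPSlices` + `BPTimeClosure`). -/
def PPCollapseUniform : Prop := PP ⊆ BPP → ∃ c : ℕ, QuadQ ⊆ BPTime fun n => n ^ c

/-- Dε piece (OPEN; ≡ CP' in every world anyone believes in): CP' granted `PP ⊄ BPP`. -/
def CP'modPP : Prop := ¬ (PP ⊆ BPP) → CP'

/-- Dε assembly (excluded middle — `trivial_seam`). -/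
theorem cp'_of_ppCases (h₁ : PPCollapseUniform) (h₂ : CP'modPP) : CP' := by
  by_cases h : PP ⊆ BPP
  · exact fun _ => h₁ h
  · exact h₂ h

/-! ## §3 The negative side, typed -/

/-- OracleDichotomy, positive form (a RELATIVIZED counterexample to CP'): an oracle with the language
collapse but no uniform classical exponent for the quadratic quantum level. Typable now
(`BQTimeRel`, `BPTimeRel`, BQTime.lean / RelativizedTime.lean); recommended signature for the
route's informal item stmt-QuantumAdvantage-15277. -/
def OracleDichotomyPos : Prop :=
  ∃ A : Language Bool, BQPRel A ⊆ BPPRel (Oracle.ofLanguage A) ∧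
    ∀ c : ℕ, ∃ L ∈ BQTimeRel A (fun n => n ^ 2), L ∉ BPTimeRel (Oracle.ofLanguage A) fun n => n ^ c

/-- Its negation at every oracle is what a RELATIVIZING proof of CP' would give (the relativized CP'). -/
def CP'Rel (A : Language Bool) : Prop :=
  BQPRel A ⊆ BPPRel (Oracle.ofLanguage A) →
    ∃ c : ℕ, BQTimeRel A (fun n => n ^ 2) ⊆ BPTimeRel (Oracle.ofLanguage A) fun n => n ^ c

theorem oracleDichotomyPos_iff : OracleDichotomyPos ↔ ∃ A, ¬ CP'Rel A := by
  constructor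
  · rintro ⟨A, hsub, hlad⟩
    refine ⟨A, fun h => ?_⟩
    obtain ⟨c, hc⟩ := h hsub
    obtain ⟨L, hL, hLc⟩ := hlad c
    exact hLc (hc hL)
  · rintro ⟨A, hA⟩
    unfold CP'Rel at hA
    push Not at hA
    obtain ⟨hsub, hne⟩ := hA
    exact ⟨A, hsub, fun c => by
      obtain ⟨L, hL, hLc⟩ := Set.not_subset.1 (hne c)
      exact ⟨L, hL, hLc⟩⟩

end Summit.QuantumAdvantage.QuantumAdvantage.Cruxes.CompactnessPrinciple.Strategist
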